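import Summits.ResolutionOfSingularities.ResolutionOfSingularities.Theorems.PurelyInseparableDim4ResConeShadeOneStep
import HarnessLib
import HarnessLib.Audit.Tags

/-!
# Purely inseparable four-folds — K2(p), THE PHASE `d = 1` IS EMPTY: no isolated above-floor `Step0 p` chain
# with `x^{r₀} ∣ F₀` has constant shade `1` (every prime; idea-4's «CORNER LOCK», card I-4-3)

[OURS · counted 0 · cell `res-dim4-pi` · seat res-dim4-p-7 g2 · K2(p) lane (holder res-dim4-p-12 lineage, desk
WORDS #74–#76: «p-7 GO on d = 1»); hand proof res-dim4-idea-4 (card I-4-3 (T)/(M1a)/(M1b)).]  Nothing here proves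
K2(p) = `RidgeBudget.NoAboveFloorTrap p p` (constant shade `2 ≤ d ≤ p − 1` stays OPEN for `p ≥ 5`),
`NoIsolatedTrap p p`, or resolution of singularities in dimension ≥ 4 / characteristic `p`.

THE CORNER LOCK (exponents only; part I = `…ResConeShadeOneStep`).  On a shade-`1` chain `N_k = |r_k| + 1` with
`W_k := |r_k| ≥ p`; the triple bound of isolation and the boundary bookkeeping give `W_{k+1} ≤ W_k`
(`shadeOne_letters`), so `W` is eventually constant; then every step is a CORNER step in a chart `j` of weight
`W − r_j = p − 1` with `r` frozen and `x^{r+e_j} ∉ supp F_k` (part I).  Here: (M1b) THE LOCK `j_{k+1} = j_k` —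
isolation of `F_{k+1}` along the `x_{j_{k+1}}`-axis produces a monomial agreeing with `x^r` off `j_{k+1}`, whose chart
preimage has degree `W + 1`, hence is `x^{r + e_i}`; `i = j_k` contradicts (M1a) at `k`, `i ≠ j_k` forces `i = j_{k+1}`
and `x^{r + e_{j_{k+1}}} ∈ supp F_{k+1}`, contradicting (M1a) at `k + 1`; (κ) with `j` locked the least `a ≥ 1` with
`x^{r + a e_j} ∈ supp F_k` drops by one per step (chart image `x^{r + (a−1) e_j}` survives cleaning) until `a = 1`,
which (M1a) forbids.  Finally `no_constantShadeOneTrap` by induction on the initial weight, and the located reduction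
**`noAboveFloorTrap_iff_noMidShadeTrap`: K2(p) ⟺ no constant-shade trap with `2 ≤ d ≤ p − 1`**.

bears_on: LADDER-RESOLUTION:D157-DOOR2 (res-dim4-pi · K2(p) · phase d = 1).  Supports
stmt-ResolutionOfSingularities-16155 (helper).
-/

set_option linter.dupNamespace false -- mandated namespace of this single-conjunct summit

noncomputable section

namespace Summit.ResolutionOfSingularities.ResolutionOfSingularities.Theorems.PIDim4

namespace ResCone

open MvPolynomial Finset
open Literature.AlgebraicGeometry.Resolution
open Literature.AlgebraicGeometry.Resolution.CentreBlowup
open Literature.AlgebraicGeometry.Resolution.Hauser2010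

variable {K : Type} [Field K]

/-! ## §3 The letters of a shade-`1` chain -/

/-- **Shade-1 bookkeeping along the chain**: `N_k = W_k + 1`, `W_k ≥ p`, and `W_{k+1} ≤ W_k` (triple bound +
boundary bookkeeping). [OURS · K2(p) phase d = 1] [cite: HauserPerlega2019PRIMS, §2 (transform D' of D)] -/
theorem shadeOne_letters (p : ℕ) [hp : Fact p.Prime] {K : Type} [Field K] [DecidableEq K] {c : ℕ → State K}
    (hc : ∀ k, IsIsolated p (c k).F ∧ Step0 p (c k) (c (k + 1)) ∧ ordZero (c k).F ≠ p ∧ (c k).shade = 1)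
    (hr0 : ∀ e ∈ (c 0).F.support, (c 0).r ≤ e) (k : ℕ) :
    ordZero (c k).F = (((c k).r.degree + 1 : ℕ) : ℕ∞) ∧ p ≤ (c k).r.degree ∧
      (c (k + 1)).r.degree ≤ (c k).r.degree := by
  have hp2 : 2 ≤ p := hp.out.two_le
  have hc2 : ∀ k, IsIsolated p (c k).F ∧ Step0 p (c k) (c (k + 1)) := fun k => ⟨(hc k).1, (hc k).2.1⟩
  have hr : ∀ k, ∀ e ∈ (c k).F.support, (c k).r ≤ e := IsolatedBand.isolated_chain_forall_le hc2 hr0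
  obtain ⟨o, ho, hpo, -⟩ := BandShade.exists_ordZero_eq p hc2 k
  have hsh := (hc k).2.2.2
  rw [BandShade.shade_eq_coe ho] at hsh
  have h1 : o - (c k).r.degree = 1 := by exact_mod_cast hsh
  have h2 := degree_r_le ho (hr k)
  have hoW : o = (c k).r.degree + 1 := by omega
  have hne : o ≠ p := fun h => (hc k).2.2.1 (by rw [ho, h])
  refine ⟨by rw [ho, hoW], by omega, ?_⟩
  -- `W_{k+1} = (o − p) + σ_k ≤ (W_k + 1 − p) + (W_k − r_j) ≤ W_k`
  obtain ⟨j, b, hw⟩ := FreeTail.exists_witnesses (K := K) (fun k => (hc k).2.1)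
  obtain ⟨-, hbk, -, -, hck⟩ := hw k
  have hdeg := degree_step_r' p (j k) (b k) (c k) ho
  rw [← hck] at hdeg
  have hσle : ∑ i ∈ Finset.univ.erase (j k), (if b k i = 0 then (c k).r i else 0) ≤
      ∑ i ∈ Finset.univ.erase (j k), (c k).r i :=
    Finset.sum_le_sum fun i _ => by split_ifs <;> omega
  have hsum := sum_erase_eq_degree_sub (c k).r (j k)
  have htri := degree_lt_apply_add_of_isIsolated (hc k).1 (hr k) (j k)
  omega

/-- **NO CONSTANT-WEIGHT SHADE-1 CHAIN** (I-4-3 (M1a)+(M1b)+(κ)): along an isolated above-floor `Step0 p` chain with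
`x^{r₀} ∣ F₀`, shade `≡ 1` and CONSTANT boundary weight `|r_k| ≡ W`, every step is a corner step with `r` fixed,
the chart is LOCKED (`j_{k+1} = j_k`), and the least `a` with `x^{r + a e_j} ∈ supp F_k` descends — impossible.
[OURS · K2(p) phase d = 1] [cite: HauserPerlega2019PRIMS, §2 (transform D' of D)] -/
theorem no_shadeOne_chain_of_degree_const (p : ℕ) [hp : Fact p.Prime] (K : Type) [Field K] [DecidableEq K]
    {c : ℕ → State K} {W : ℕ}
    (hc : ∀ k, IsIsolated p (c k).F ∧ Step0 p (c k) (c (k + 1)) ∧ ordZero (c k).F ≠ p ∧ (c k).shade = 1)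
    (hr0 : ∀ e ∈ (c 0).F.support, (c 0).r ≤ e) (hW : ∀ k, (c k).r.degree = W) : False := by
  have hp2 : 2 ≤ p := hp.out.two_le
  have hc2 : ∀ k, IsIsolated p (c k).F ∧ Step0 p (c k) (c (k + 1)) := fun k => ⟨(hc k).1, (hc k).2.1⟩
  have hr : ∀ k, ∀ e ∈ (c k).F.support, (c k).r ≤ e := IsolatedBand.isolated_chain_forall_le hc2 hr0
  obtain ⟨j, b, hw⟩ := FreeTail.exists_witnesses (K := K) (fun k => (hc k).2.1)
  have hletters := shadeOne_letters p hc hr0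
  have ho' : ∀ k, ordZero (c k).F = ((W + 1 : ℕ) : ℕ∞) := fun k => by rw [(hletters k).1, hW k]
  have hpW : p ≤ W := by rw [← hW 0]; exact (hletters 0).2.1
  have hq : ∀ k, (p : ℕ∞) ≤ ordAlong Finset.univ (c k).F := fun k => (hw k).1
  -- §2 at every index
  have hstep : ∀ k, b k = 0 ∧ (c (k + 1)).r = (c k).r ∧ (c k).r.degree + 1 = (c k).r (j k) + p ∧
      (∀ i, 1 ≤ (c k).r i ∧ (c k).r i ≤ p - 2) ∧ (c k).r + Finsupp.single (j k) 1 ∉ (c k).F.support := by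
    intro k
    obtain ⟨-, hbk, -, -, hck⟩ := hw k
    have h := shadeOne_step hp2 hbk hpW (hc k).1 (hr k) (ho' k) (hW k)
      (by rw [← hck]; exact ho' (k + 1)) (by rw [← hck]; exact hW (k + 1))
    rw [← hck] at h
    exact h
  -- the boundary is frozen: `r_k = r₀`
  have hrr : ∀ k, (c k).r = (c 0).r := by
    intro k
    induction k with
    | zero => rfl
    | succ k ih => rw [(hstep k).2.1, ih]
  have hck0 : ∀ k, c (k + 1) = CentreBlowup.step p Finset.univ (j k) (0 : Fin 4 → K) (c k) := by
    intro k
    obtain ⟨-, -, -, -, hck⟩ := hw k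
    rw [hck, (hstep k).1]
  have hwt : ∀ k, (c 0).r.degree + 1 = (c 0).r (j k) + p := fun k => by
    have := (hstep k).2.2.1; rwa [hrr k] at this
  have hri : ∀ i, 1 ≤ (c 0).r i ∧ (c 0).r i ≤ p - 2 := (hstep 0).2.2.2.1
  have hM1a : ∀ k, (c 0).r + Finsupp.single (j k) 1 ∉ (c k).F.support := fun k => by
    have := (hstep k).2.2.2.2; rwa [hrr k] at this
  have hrk : ∀ k, ∀ e ∈ (c k).F.support, (c 0).r ≤ e := fun k e he => by
    have := hr k e he; rwa [hrr k] at this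
  have hws : ∀ k, ∑ i ∈ Finset.univ.erase (j k), (c 0).r i = p - 1 := fun k => by
    rw [sum_erase_eq_degree_sub]; have := hwt k; omega
  -- THE LOCK (M1b): consecutive charts coincide
  have hlock : ∀ k, j (k + 1) = j k := by
    intro k
    by_contra hne
    obtain ⟨E, hE, hEr⟩ :=
      exists_axis_monomial (hc (k + 1)).1 (hrk (k + 1)) (j (k + 1)) (hws (k + 1)) (by omega)
    have hE' := hE
    rw [hck0 k] at hE'
    obtain ⟨e, he, heE⟩ := exists_of_mem_support_step_zero (j k) (c k) hE'
    -- the degree of the preimage is `W + 1`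
    have hEj : E (j k) = e.degree - p := by
      rw [← heE, chartExponent_univ_eq_update, Finsupp.update_apply, if_pos rfl]
    have hEj' : E (j k) = (c 0).r (j k) := hEr (j k) (fun h => hne h.symm)
    have hpe : p ≤ e.degree := le_degree_of_mem_support (hq k) he
    have hdeg_e : e.degree = (c 0).r.degree + 1 := by have := hwt k; omega
    obtain ⟨i, hi⟩ := exists_eq_add_single_of_le_of_degree (hrk k e he) hdeg_e
    by_cases hij : i = j k
    · rw [hij] at hi
      exact hM1a k (hi ▸ he)
    · have hEi : E = (c 0).r + Finsupp.single i 1 := by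
        rw [← heE, hi, chartExponent_add_single_of_ne p hij (c 0).r (hwt k)]
      by_cases hij' : i = j (k + 1)
      · rw [hij'] at hEi
        exact hM1a (k + 1) (hEi ▸ hE)
      · have h1 := hEr i hij'
        rw [hEi, Finsupp.coe_add, Pi.add_apply, Finsupp.single_eq_same] at h1
        omega
  have hj : ∀ k, j k = j 0 := by
    intro k
    induction k with
    | zero => rfl
    | succ k ih => rw [hlock k, ih]
  -- THE DESCENT (κ) at the locked chart `j 0`
  obtain ⟨E, hE, hEr⟩ := exists_axis_monomial (hc 0).1 (hrk 0) (j 0) (hws 0) (by omega)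
  have hEeq := eq_add_single_of_forall_ne (hrk 0 E hE) hEr
  set a := E (j 0) - (c 0).r (j 0) with ha_def
  have ha1 : 1 ≤ a := by
    -- `|E| ≥ ord F₀ = W + 1 > W = |r|`
    by_contra hlt
    have h0 : a = 0 := by omega
    rw [h0, Finsupp.single_zero, add_zero] at hEeq
    have hzero := ((ordZero_eq_nat_iff _ _).mp (ho' 0)).2 (c 0).r (by rw [hW 0]; omega)
    exact (MvPolynomial.mem_support_iff.mp (hEeq ▸ hE)) hzero
  obtain ⟨i₁, hi₁⟩ := exists_ne (j 0)
  have hdesc : ∀ m, m + 1 ≤ a → (c 0).r + Finsupp.single (j 0) (a - m) ∈ (c m).F.support := by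
    intro m
    induction m with
    | zero => intro _; rw [Nat.sub_zero, ← hEeq]; exact hE
    | succ m ih =>
      intro hm
      have hmem := ih (by omega)
      have hnp : ¬ IsPthPowerExponent p
          (chartExponent p Finset.univ (j m) ((c 0).r + Finsupp.single (j 0) (a - m))) := by
        rw [hj m, chartExponent_add_single_self p (j 0) (c 0).r (hwt 0) (by omega)]
        refine not_isPthPowerExponent_of_not_dvd (i := i₁) ?_
        rw [Finsupp.coe_add, Pi.add_apply, Finsupp.single_apply, if_neg (fun h => hi₁ h.symm), add_zero]
        exact Nat.not_dvd_of_pos_of_lt (by have := hri i₁; omega) (by have := hri i₁; omega)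
      have h := chartExponent_mem_support_step_zero (j m) (c m) (hq m) hmem hnp
      rw [← hck0 m, hj m, chartExponent_add_single_self p (j 0) (c 0).r (hwt 0) (by omega)] at h
      rw [show a - (m + 1) = a - m - 1 by omega]
      exact h
  have hlast := hdesc (a - 1) (by omega)
  rw [show a - (a - 1) = 1 by omega, ← hj (a - 1)] at hlast
  exact hM1a (a - 1) hlast

/-! ## §4 The phase `d = 1` is empty -/

/-- **K2(p), THE PHASE `d = 1` IS EMPTY** (idea-4 «CORNER LOCK», card I-4-3; every prime `p`): over a field of
characteristic `p` there is no infinite `Step0 p` chain of ISOLATED states with `x^{r₀} ∣ F₀`, all off the floor,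
of constant shade `1`.  (The boundary weight `W` is non-increasing, so eventually constant; then
`no_shadeOne_chain_of_degree_const`.)  With `…ResConeShadeZero` (`d = 0`) and `…ResConeSliceA` (`d ≥ p`) the located
residue of K2(p) is constant shade `2 ≤ d ≤ p − 1`. [OURS · K2(p) phase d = 1]
[cite: HauserPerlega2019PRIMS, §2 (transform D' of D)] -/
theorem no_constantShadeOneTrap (p : ℕ) [hp : Fact p.Prime] (K : Type) [Field K] [DecidableEq K] :
    ¬ ∃ c : ℕ → State K, (∀ e ∈ (c 0).F.support, (c 0).r ≤ e) ∧
      ∀ k, IsIsolated p (c k).F ∧ Step0 p (c k) (c (k + 1)) ∧ ordZero (c k).F ≠ p ∧ (c k).shade = 1 := by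
  rintro ⟨c, hr0, hc⟩
  have hp2 : 2 ≤ p := hp.out.two_le
  suffices h : ∀ (n : ℕ) (c : ℕ → State K), (∀ e ∈ (c 0).F.support, (c 0).r ≤ e) →
      (∀ k, IsIsolated p (c k).F ∧ Step0 p (c k) (c (k + 1)) ∧ ordZero (c k).F ≠ p ∧ (c k).shade = 1) →
      (c 0).r.degree ≤ n → False from h _ c hr0 hc le_rfl
  intro n
  induction n with
  | zero =>
    intro c hr0 hc hle
    have := (shadeOne_letters p hc hr0 0).2.1
    omega
  | succ n ih =>
    intro c hr0 hc hle
    by_cases hconst : ∀ k, (c k).r.degree = (c 0).r.degree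
    · exact no_shadeOne_chain_of_degree_const p K hc hr0 hconst
    · push Not at hconst
      obtain ⟨k, hk⟩ := hconst
      have hanti : Antitone fun k => (c k).r.degree :=
        antitone_nat_of_succ_le fun k => (shadeOne_letters p hc hr0 k).2.2
      have hkle : (c k).r.degree ≤ (c 0).r.degree := hanti (Nat.zero_le k)
      have hlt : (c k).r.degree < (c 0).r.degree := lt_of_le_of_ne hkle hk
      have hc2 : ∀ k, IsIsolated p (c k).F ∧ Step0 p (c k) (c (k + 1)) := fun k => ⟨(hc k).1, (hc k).2.1⟩
      exact ih (fun m => c (k + m)) (IsolatedBand.isolated_chain_forall_le hc2 hr0 k)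
        (fun m => hc (k + m)) (by simp only [Nat.add_zero]; omega)

/-- **K2(p) ⟺ NO MID-SHADE TRAP** (every prime `p`): `RidgeBudget.NoAboveFloorTrap p p` holds iff over every field of
characteristic `p` there is no isolated above-floor `Step0 p` chain with `x^{r₀} ∣ F₀` and CONSTANT shade `d` with
`2 ≤ d ≤ p − 1` — `…SliceA` (`d ≥ p`), `…ShadeZero` (`d = 0`, res-dim4-p-12 g2) and `no_constantShadeOneTrap`
(`d = 1`) removed from res-dim4-p-12 g2's «K2(p) ⟺ BCP(p)».  At `p = 5`: `d ∈ {2, 3, 4}` (idea-4's BCP′(5)).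
[OURS · K2(p) located reduction] [cite: HauserPerlega2019PRIMS, §2 (transform D' of D)] -/
theorem noAboveFloorTrap_iff_noMidShadeTrap (p : ℕ) [hp : Fact p.Prime] :
    RidgeBudget.NoAboveFloorTrap p p ↔ ∀ (K : Type) [Field K] [CharP K p] [DecidableEq K],
      ¬ ∃ (c : ℕ → State K) (d : ℕ), 2 ≤ d ∧ d < p ∧ (∀ e ∈ (c 0).F.support, (c 0).r ≤ e) ∧
        ∀ k, IsIsolated p (c k).F ∧ Step0 p (c k) (c (k + 1)) ∧ ordZero (c k).F ≠ p ∧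
          (c k).shade = (d : ℕ∞) := by
  rw [noAboveFloorTrap_iff_noLowShadeTrap]
  constructor
  · intro h K _ _ _
    rintro ⟨c, d, -, hdp, hr0, hc⟩
    exact h K ⟨c, d, hdp, hr0, hc⟩
  · intro h K _ _ _
    rintro ⟨c, d, hdp, hr0, hc⟩
    rcases Nat.lt_or_ge d 2 with hd | hd
    · interval_cases d
      · exact noConstantShadeZeroTrap p K
          ⟨c, hr0, fun k => ⟨(hc k).1, (hc k).2.1, by simpa using (hc k).2.2.2⟩⟩
      · exact no_constantShadeOneTrap p K
          ⟨c, hr0, fun k => ⟨(hc k).1, (hc k).2.1, (hc k).2.2.1, by simpa using (hc k).2.2.2⟩⟩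
    · exact h K ⟨c, d, hd, hdp, hr0, hc⟩

end ResCone

end Summit.ResolutionOfSingularities.ResolutionOfSingularities.Theorems.PIDim4

end
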